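/-
Origin: expansion seat `literature-prover-pub-hodgecm-cf-kudla-howe-rallis-g2-0`, handover #3 2026-08-18T05:02:26Z (`HOME/pub-hodgecm-cf-kudla-howe-rallis-g2/WeilTheta1964.lean`, md5 56e4c79d, 147 lines);
landed by the gen-6 packager in gate run 22 as `HodgeCM/Literature/WeilTheta1964.lean` (verbatim).
-/
/-
Origin: HOME/pub-hodgecm-cf-kudla-howe-rallis-g2/WeilTheta1964.lean — session
literature-prover-pub-hodgecm-cf-kudla-howe-rallis-g2-0 (unit pub-hodgecm-cf-kudla-howe-rallis-g2, CITED-FACT seat (4) gen 2),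
answering GAPS.md adv1g5-O5 (adversarial reader 1, gen 5: "the analytic PRINT input of §3 has no theorem number / page
anywhere in the cell").  Intended place: `HodgeCM/Literature/WeilTheta1964.lean` (imports `Mathlib` only).  Companion prose:
HOME/CITED-FACTS.md § pub-hodgecm-cf-kudla-howe-rallis-g2, KHR-19.
-/
import Mathlib

set_option autoImplicit false

/-!
# Continuity of the adelic Weil representation and of theta series (A. Weil 1964, Chap. III n° 39–41:
# Théorème 6, Lemme 5) — the analytic input of PerL v5 §3.3 (nodes N18, N21, N22, N23b; Thm 3.7)

Typing discipline as in `HodgeCM/Literature/ThetaCorrespondence.lean`: each printed statement is a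
`def … : Prop` over a structure of BARE CARRIERS (here: topological spaces and bare functions); nothing is
asserted; the consumer takes `(h : …)` for ITS datum.  The package's consumers are the hypothesis
`hθc : Continuous (Function.uncurry (P.θ P.Φ))` / the `Regular` record of `HodgeCM/PerL34/P36_fd.lean` (pv14)
and `ThetaPeriodCont` (pv11), which until now carried the label "PRINT: Weil 1964" without a locator.

Source (HELD, corpus key `paper:doi-10-1007-bf02391012`, OCR of the Springer PDF; pNNNN = printed page
143 + NNNN − 1): A. Weil, *Sur certains groupes d'opérateurs unitaires*, Acta Math. 111 (1964) 143–211,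
doi:10.1007/BF02391012.  Quotations below were read on p0047 (= p. 189), p0051 (= p. 193), p0052 (= p. 194);
accents restored from the OCR.
-/

noncomputable section

universe u

namespace HodgeCM.Literature.Theta

/-- **Carriers for [We64, Chap. III, n° 37–41, pp. 187–194]**: `k` an A-field (number field), `X_k` a
finite-dimensional vector space over `k`, `X_A` its adelisation, `S(X_A)` the Schwartz–Bruhat space with its
topology (n° 11, n° 29), `Mp(X)_A` the adelic metaplectic group — a topological group acting on `S(X_A)` by
unitary operators `(S, Φ) ↦ SΦ` — and `r_k : Ps(X)_k → Mp(X)_A` the canonical lift of the rational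
pseudo-symplectic group (n° 38, p. 189: "on a défini ainsi un relèvement continu `r_k` de `Ps(X)_k` dans
`Mp(X)_A`");
* `Mp` — `Mp(X)_A` (topological group); `SX` — `S(X_A)` (topological space); `act S Φ` — `SΦ`;
* `rat` — the subset `{r_k(s) : s ∈ Ps(X)_k} ⊂ Mp(X)_A`;
* `theta Φ S` — `Θ(S) = Σ_{ξ ∈ X_k} (SΦ)(ξ)` (n° 41). -/
structure WeilThetaDatum where
  /-- `Mp(X)_A` -/
  Mp : Type u
  [instTop : TopologicalSpace Mp]
  [instGrp : Group Mp]
  /-- `S(X_A)` -/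
  SX : Type u
  [instTopS : TopologicalSpace SX]
  /-- `(S, Φ) ↦ SΦ` -/
  act : Mp → SX → SX
  /-- `r_k(Ps(X)_k) ⊂ Mp(X)_A` -/
  rat : Set Mp
  /-- `Φ ↦ (S ↦ Θ(S) = Σ_{ξ ∈ X_k} (SΦ)(ξ))` -/
  theta : SX → Mp → ℂ

attribute [instance] WeilThetaDatum.instTop WeilThetaDatum.instGrp WeilThetaDatum.instTopS

namespace WeilThetaDatum

variable (D : WeilThetaDatum.{u})

/-- **Continuity of the adelic Weil representation (Weil).**  AS PRINTED [We64, Chap. III, **n° 39**, p. 189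
(p0047 L21–L23)]: "Comme dans le cas local, on va montrer maintenant que `(S, Φ) → SΦ` détermine une
application continue de `Mp(X)_A × S(X_A)` dans `S(X_A)`" (proved in n° 39–40).
TYPING: joint continuity of `act`.
PerL v5 USE: §3.3 l. 342 (node N18) "`ω` is a continuous representation of `U(W)(𝔸) × G_U(𝔸)` on `𝒮`" —
composed with the continuous splitting `U(W)(𝔸) × G_U(𝔸) → Mp(𝕎)_A` ([Ku94]/[HKS96 §1]; `ThetaCorrespondence`
§6).  MISMATCH: none (Weil's `S(X_A)` is the full Schwartz–Bruhat space; PerL's `𝒮` takes Fock polynomials at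
the archimedean places — a subspace, l. 341). -/
def ActionContinuous : Prop :=
  Continuous (Function.uncurry D.act)

/-- **Continuity and automorphy of theta series (Weil).**  AS PRINTED [We64, Chap. III, n° 41,
**Théorème 6**, p. 193 (p0051 L27–L34)]: "Soient `X_k` un espace vectoriel de dimension finie sur `k`, et `Φ`
une fonction appartenant à `S(X_A)`.  Soit `Θ` la fonction sur `Mp(X)_A`, définie, pour tout `S ∈ Mp(X)_A`,
par la formule `Θ(S) = Σ_{ξ ∈ X_k} (SΦ)(ξ)`.  Alors `Θ` est une fonction continue sur `Mp(X)_A`, invariante par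
les translations à gauche déterminées par les éléments de `Mp(X)_A` de la forme `r_k(s)`, avec `s ∈ Ps(X)_k`."
(Proof pp. 193–194 via Lemme 4, Lemme 5: "Soit `C` une partie compacte de `Mp(X)_A`; si `Φ ∈ S(X_A)`,
l'image de `C` par `S → SΦ` est une partie compacte de `S(X_A)`, et il résulte donc du lemme 5 qu'il existe
`Φ₀ ∈ S(X_A)` telle que `|SΦ| ≤ Φ₀` quel que soit `S ∈ C`.  La série qui définit `Θ(S)` est donc, pour
`S ∈ C`, majorée terme à terme par la série `Σ Φ₀(ξ)`.  Celle-ci étant convergente d'après ce qui précède,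
cela achève la démonstration.")
TYPING: conjunct 1 = continuity of `S ↦ Θ(S)` for each `Φ`; conjunct 2 = left-invariance under `rat`.
PerL v5 USE: §3.3 l. 381 (node N21: "`θ_Φ` is continuous on the compact space `[G_U] × [U(W)]`"),
ll. 394–396 (node N22: "the kernel `θ_Φ` is continuous on `[G_U] × U(W)(𝔸)` … jointly continuous"), l. 413
(N23b), Thm 3.7 l. 453; package binder `hθc : Continuous (Function.uncurry (P.θ P.Φ))` (`P36_fd.lean`,
`Regular`) — kernel corollary `theta_comp_continuous` below (`θ_Φ(g, h) = Θ(s(g, h))` with `s` the continuous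
splitting map).  PerL l. 343 "`Φ ↦ θ_Φ` is continuous from `𝒮` to `C([G_U] × [U(W)])` (uniform norm)" is
Weil's proof argument (Lemme 5 domination on the compact image of `{Φ_n} × 𝒞`, `𝒞` a compact fundamental
set) — PRINT-DERIVED (GAPS adv1g5-O5), not a numbered statement; not typed.  MISMATCH: none. -/
def ThetaContinuousInvariant : Prop :=
  (∀ Φ : D.SX, Continuous (D.theta Φ)) ∧
  ∀ (Φ : D.SX) (γ : D.Mp), γ ∈ D.rat → ∀ S : D.Mp, D.theta Φ (γ * S) = D.theta Φ S

variable {D}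

/-- **PerL's binder `hθc`, kernel-checked from Théorème 6:** the theta kernel pulled back along ANY
continuous map `s : Y → Mp(X)_A` (PerL: `Y = U(W)(𝔸) × G_U(𝔸)`, `s` = the Kudla–HKS splitting, continuous) is
continuous — PerL ll. 381, 394–396. -/
theorem ThetaContinuousInvariant.theta_comp_continuous (h : D.ThetaContinuousInvariant) (Φ : D.SX)
    {Y : Type*} [TopologicalSpace Y] {s : Y → D.Mp} (hs : Continuous s) :
    Continuous fun y => D.theta Φ (s y) :=
  (h.1 Φ).comp hs

/-- **Automorphy, kernel-checked from Théorème 6:** `Θ` is invariant under left translation by the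
rational elements, so `θ_Φ` descends to `Ps(X)_k \ Mp(X)_A` (PerL l. 266–267: `θ_Φ` is a function on
`[U(W)] × [G_U]`). -/
theorem ThetaContinuousInvariant.theta_left_invariant (h : D.ThetaContinuousInvariant) (Φ : D.SX)
    {γ : D.Mp} (hγ : γ ∈ D.rat) (S : D.Mp) : D.theta Φ (γ * S) = D.theta Φ S :=
  h.2 Φ γ hγ S

end WeilThetaDatum

/-- **Carriers for [We64, Lemme 5, p. 194]**: `G` a locally compact abelian group, `S(G)` its
Schwartz–Bruhat space (n° 11) with its topology; `eval Φ x = Φ(x)`. -/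
structure SchwartzBruhatDatum where
  /-- the group `G` -/
  G : Type u
  /-- `S(G)` -/
  SG : Type u
  [instTop : TopologicalSpace SG]
  /-- `Φ ↦ (x ↦ Φ(x))` -/
  eval : SG → G → ℂ

attribute [instance] SchwartzBruhatDatum.instTop

namespace SchwartzBruhatDatum

variable (D : SchwartzBruhatDatum.{u})

/-- **Domination on compact sets of Schwartz–Bruhat functions (Weil).**  AS PRINTED [We64, Chap. III, n° 41,
**Lemme 5**, p. 194 (p0052 L7–L9)]: "Soient `G` un groupe abélien localement compact et `C` une partie
compacte de `S(G)`.  Alors il existe `Φ₀ ∈ S(G)` telle que `|Φ(x)| ≤ Φ₀(x)` quels que soient `Φ ∈ C` et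
`x ∈ G`."
TYPING (WEAKER than print): `|Φ(x)| ≤ |Φ₀(x)|` (print has `Φ₀ ≥ 0` real-valued, so `Φ₀(x) = |Φ₀(x)|`).
PerL v5 USE: the domination step behind l. 343 / l. 413 (uniform convergence of the theta series on compact
sets; absolute convergence) — see `ThetaContinuousInvariant`.  MISMATCH: none. -/
def CompactDomination : Prop :=
  ∀ C : Set D.SG, IsCompact C → ∃ Φ₀ : D.SG, ∀ Φ ∈ C, ∀ x : D.G, ‖D.eval Φ x‖ ≤ ‖D.eval Φ₀ x‖

end SchwartzBruhatDatum

end HodgeCM.Literature.Theta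

end
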